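import Summits.ResolutionOfSingularities.ResolutionOfSingularities.Theorems.PurelyInseparableDim4LoopCRegion
import Summits.ResolutionOfSingularities.ResolutionOfSingularities.Theorems.PurelyInseparableDim4InScopeWinCert
import HarnessLib

/-!
# [OURS · res-dim4-pi · F4-C-loc] LOOP-C HAS NO PLAY IN THE LOCAL GAME: the six region states are A-wins within
  two moves once B must answer OVER THE CURRENT POINT (kernel form of desk ruling R1, WORD #45 (3) / #51 (b))

Cell `res-dim4-pi` (D-0157 DOOR 2, wave 2), seat `res-dim4-p-6` g2; companion of `res-dim4-p-8` g2's GLOBAL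
certificate `PurelyInseparableDim4LoopCRegion.lean` (p662411: over `𝔽₃` at `(p,q) = (3,3)` the six LOOP-C states
`LoopC.t0 … t5` form a region closed for B in the frame's game `Edge`, whose replies `b` may move ALONG the
centre; every maximal-dimensional-component rule is beaten there).  Sources: idea-2 g2 LOOP-C (K = B eng-w5 g2 ·
eng-w4 g2 · crit-4 V-A4-12 · crit-5 g2 T-A5-01 · crit-1 T-A-07); the LOCAL reading («B answers over the current
point only: `bᵢ = 0` off the centre») is crit-1's R1 question, ruled ADDITIVE by the desk (WORD #45): the
tree's `Edge`/`TerminatesInScope` stay the GLOBAL game of record, the local game is typed next to it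
(`res-dim4-p-13`'s `EdgeLoc`/`TerminatesInScopeLoc`, pending; the reply class `localB` below is its `b`-side,
stated inline as the desk allows until that file lands).

* §1 **Reply-class games.**  `RSucc q ρ` = the frame's edge relation with B's replies `(S, j, b)` restricted to
  a Boolean class `ρ S j b`; `RWins q ρ` = A's in-scope attractor over it (p-14's `InScopeStateWins` is the class
  `⊤`: `rWins_top_iff`).  **`wins_antitone_succ`** (abstract: shrinking B's replies keeps A's wins) ⇒
  **`rWins_mono`**, **`rWins_of_inScopeStateWins`** — every GLOBAL in-scope win is a win in every restricted
  game, in particular the LOCAL one (`localB S j b := ∀ i ∉ S, bᵢ = 0`): the state-level form of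
  «`TerminatesInScope` ⇒ local termination».
* §2 **Restricted win certificates** `rwinCertB q ρ` = p-14's `iwinCertB` (`ICert` rows: BLIND ∨ origin not
  `q`-fold ∨ a permissible centre all of whose `K`-rational `ρ`-replies are non-equimultiple, kill `F`, or are
  certified later) with the reply quantifier cut down to `ρ`; soundness **`rWins_of_rwinCertB`**.
* §3 **LOOP-C, local side (‖ K, `decide`)**: `no_local_reply_t1/t2/t4/t5` — at the four one-component states
  the forced blow-up of the unique maximal-dimensional component `V(x₂,x₄)` / `V(x₁,x₄)` / mirrors has NO
  `𝔽₃`-rational equimultiple reply over the current point (crit-4: «chart x₁: coefficient of `x₄²` is a unit,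
  chart x₄: `x₁` appears linearly»; crit-5: no `3`-fold point in the fibre even over `𝔽̄₃` — not claimed here);
  `hops_not_local` — LOOP-C's four replies at these states are HOPS (`b₃ ≠ 0` resp. `b₄ ≠ 0` off the centre);
  **`rwinCertB_loopCLocal`** — the six-row local certificate (at `t0`/`t3` the only local equimultiple reply
  to `V(x₁,x₄)` is the origin of the `x₁`-chart, landing on `t1`/`t4`).
* §4 **`loopC_localWins`** — every state of p-8's region `LoopC.trapSet LoopC.loopC` is an A-win of the LOCAL
  in-scope game over `𝔽₃`, A playing the very maximal-dimensional components that lose the global game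
  (`LoopC.exists_inScope_branch_of_maxDimRule`): **`loopC_separates`** records both halves side by side —
  LOOP-C is the specimen SEPARATING F4-C-glob from F4-C-loc at `(3,3)`.

Scope (honest): `𝔽₃`-rational replies, `(p,q) = (3,3)`, the six literal states; statements about OUR frame and
its two game readings; nothing here decides `TerminatesInScope 3 3` in either reading for a general rule, and
NOTHING here is a statement about resolution of singularities — resolution in dimension `≥ 4` /
characteristic `p > 0` is NOT proved by anything in this file.  [OURS · counted 0 · kernel certificate + elementary
game bookkeeping; AI kernel work, weaker than expert review.]  bears_on: LADDER-RESOLUTION:D157-DOOR2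
(res-dim4-pi · F4-C-loc(3,3) · C-LOOP-C).  Host item (DR-157-C): `stmt-ResolutionOfSingularities-16155`, helper.
-/

set_option linter.dupNamespace false -- mandated namespace of this single-conjunct summit

noncomputable section

open MvPolynomial Finset

namespace Summit.ResolutionOfSingularities.ResolutionOfSingularities.Theorems.PIDim4

namespace LoopCLocal

open Literature.AlgebraicGeometry.Resolution
open Literature.AlgebraicGeometry.Resolution.CentreBlowup
open StepKit WinCertSound ScopeBlind InScopeWinCert LoopC

/-! ## §1 Reply-class games and the monotonicity in B's replies -/

/-- **Shrinking B's replies keeps A's wins** (abstract reachability games): if every `succ'`-answer is a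
`succ`-answer, A's attractor for `succ` is contained in A's attractor for `succ'`. OURS (elementary). [folklore] -/
theorem wins_antitone_succ {P M : Type} {legal : P → M → Prop} {succ succ' : P → M → P → Prop}
    (h : ∀ x m y, succ' x m y → succ x m y) {x : P} (hx : Game.Wins legal succ x) :
    Game.Wins legal succ' x := by
  induction hx with
  | terminal h0 => exact Game.Wins.terminal h0
  | @move x m hm _ ih => exact Game.Wins.move (m := m) hm fun y hy => ih y (h x m y hy)

variable {K : Type} [Field K] [DecidableEq K]

/-- **The frame's edge with B's replies restricted to a class `ρ`**: chart `j ∈ S`, point `b` with `b_j = 0`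
AND `ρ S j b`, equimultiple, non-zero cleaned transform, `t'` the transform (`ρ ≡ true` is the tree's `Edge`,
`rSucc_top_iff`). OURS. [folklore] -/
def RSucc (q : ℕ) (ρ : Finset (Fin 4) → Fin 4 → (Fin 4 → K) → Bool) (t : State K) (S : Finset (Fin 4))
    (t' : State K) : Prop :=
  ∃ (j : Fin 4) (b : Fin 4 → K), j ∈ S ∧ b j = 0 ∧ ρ S j b = true ∧ IsEquimultiplePoint q S j b t ∧
    (CentreBlowup.step q S j b t).F ≠ 0 ∧ t' = CentreBlowup.step q S j b t

/-- **A's in-scope attractor of the `ρ`-restricted game**: A moves a permissible coordinate centre at an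
in-scope state; B answers inside the class `ρ` (p-14's `InScopeStateWins` is `ρ ≡ true`, `rWins_top_iff`).
OURS. [folklore] -/
def RWins (q : ℕ) (ρ : Finset (Fin 4) → Fin 4 → (Fin 4 → K) → Bool) (s : State K) : Prop :=
  Game.Wins (fun (t : State K) (S : Finset (Fin 4)) => InCoordinateScope q t.F ∧ IsPermissibleCentre q S t.F)
    (RSucc q ρ) s

/-- **The LOCAL reply class**: B answers over the CURRENT POINT — no coordinate off the centre moves
(`bᵢ = 0` for `i ∉ S`; the fibre coordinates `bᵢ`, `i ∈ S ∖ {j}`, are free).  This is the `b`-side of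
res-dim4-p-13's `EdgeLoc` (WORD #45 (2)), written as a Boolean class. OURS. [folklore] -/
def localB (S : Finset (Fin 4)) (_j : Fin 4) (b : Fin 4 → K) : Bool :=
  decide (∀ i : Fin 4, i ∉ S → b i = 0)

/-- `localB` says exactly «`b` vanishes off the centre». OURS. [folklore] -/
theorem localB_eq_true_iff (S : Finset (Fin 4)) (j : Fin 4) (b : Fin 4 → K) :
    localB S j b = true ↔ ∀ i : Fin 4, i ∉ S → b i = 0 := by
  simp [localB]

/-- The unrestricted class is the tree's `Edge`. OURS. [folklore] -/
theorem rSucc_top_iff (q : ℕ) (t : State K) (S : Finset (Fin 4)) (t' : State K) :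
    RSucc q (fun _ _ _ => true) t S t' ↔ Edge q S t t' := by
  constructor
  · rintro ⟨j, b, hj, hb, -, heq, hne, ht⟩
    exact ⟨j, b, hj, hb, heq, hne, ht⟩
  · rintro ⟨j, b, hj, hb, heq, hne, ht⟩
    exact ⟨j, b, hj, hb, rfl, heq, hne, ht⟩

/-- **`RWins q ⊤ = InScopeStateWins q`** (p-14's in-scope attractor of the GLOBAL game). OURS. [folklore] -/
theorem rWins_top_iff (q : ℕ) (s : State K) :
    RWins q (fun _ _ _ => true) s ↔ InScopeStateWins q s :=
  ⟨fun h => wins_antitone_succ (fun x m y hy => (rSucc_top_iff q x m y).mpr hy) h,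
    fun h => wins_antitone_succ (fun x m y hy => (rSucc_top_iff q x m y).mp hy) h⟩

/-- **Monotonicity in the reply class**: a smaller class for B keeps every A-win. OURS. [folklore] -/
theorem rWins_mono {q : ℕ} {ρ ρ' : Finset (Fin 4) → Fin 4 → (Fin 4 → K) → Bool}
    (hρ : ∀ S j b, ρ' S j b = true → ρ S j b = true) {s : State K} (h : RWins q ρ s) : RWins q ρ' s := by
  refine wins_antitone_succ (fun x m y hy => ?_) h
  obtain ⟨j, b, hj, hb, hρ', heq, hne, hy'⟩ := hy
  exact ⟨j, b, hj, hb, hρ m j b hρ', heq, hne, hy'⟩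

/-- **A GLOBAL in-scope win is a win in every restricted game** — in particular in the LOCAL game: the
state-level form of «`TerminatesInScope p q` ⇒ local termination» (restrict B, keep A). OURS. [folklore] -/
theorem rWins_of_inScopeStateWins {q : ℕ} (ρ : Finset (Fin 4) → Fin 4 → (Fin 4 → K) → Bool) {s : State K}
    (h : InScopeStateWins q s) : RWins q ρ s :=
  rWins_mono (fun _ _ _ _ => rfl) ((rWins_top_iff q s).mpr h)

/-- Hence F4-C of record (GLOBAL) puts every state over every field of characteristic `p` in A's attractor of
every restricted game, the local one included. OURS. [folklore] -/
theorem forall_rWins_of_terminatesInScope {p q : ℕ} (h : TerminatesInScope p q)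
    (K : Type) [Field K] [CharP K p] [DecidableEq K]
    (ρ : Finset (Fin 4) → Fin 4 → (Fin 4 → K) → Bool) (s : State K) : RWins q ρ s :=
  rWins_of_inScopeStateWins ρ ((terminatesInScope_iff_forall_inScopeStateWins p q).mp h K s)

/-! ## §2 Restricted win certificates (p-14's `ICert` checker with the reply quantifier cut down to `ρ`) -/

section Cert

variable [Fintype K]

/-- The row check of the `ρ`-restricted game: BLIND, or TERMINAL (origin not `q`-fold), or a permissible
centre all of whose `K`-rational replies IN THE CLASS `ρ` are harmless (`InScopeWinCert.ireplyOK`: not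
equimultiple, or `F` dies, or the child is certified later). OURS. [folklore] -/
def rrowOK (q : ℕ) (ρ : Finset (Fin 4) → Fin 4 → (Fin 4 → K) → Bool) (rest : ICert K) (row : IRow K) :
    Bool :=
  blindOK q row || !(permB q Finset.univ row.1.L) ||
    (permB q row.2.1 row.1.L &&
      decide (∀ j ∈ row.2.1, ∀ b : Fin 4 → K, b j = 0 → ρ row.2.1 j b = true →
        ireplyOK q rest row.1 row.2.1 j b = true))

/-- **The `ρ`-restricted win-certificate checker.** OURS. [folklore] -/
def rwinCertB (q : ℕ) (ρ : Finset (Fin 4) → Fin 4 → (Fin 4 → K) → Bool) : ICert K → Bool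
  | [] => true
  | row :: rest => rrowOK q ρ rest row && rwinCertB q ρ rest

/-- **SOUNDNESS of one row.** OURS (p-14's `inScopeStateWins_of_irowOK`, restricted). [folklore] -/
theorem rWins_of_rrowOK {q : ℕ} {ρ : Finset (Fin 4) → Fin 4 → (Fin 4 → K) → Bool} {rest : ICert K}
    (hrest : ∀ r ∈ rest, RWins q ρ r.1.toState) {row : IRow K}
    (h : rrowOK q ρ rest row = true) : RWins q ρ row.1.toState := by
  unfold rrowOK at h
  rw [Bool.or_eq_true, Bool.or_eq_true] at h
  rcases h with (hblind | hterm) | hmove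
  · -- a blindness certificate: the state is out of scope, A has no legal move, the position is won
    unfold blindOK at hblind
    obtain ⟨s, S, oβ⟩ := row
    cases oβ with
    | none => exact absurd hblind Bool.false_ne_true
    | some β => exact Game.Wins.terminal fun _ hS => (not_inCoordinateScope_of_check hblind) hS.1
  · -- terminal: the origin is not `q`-fold, no permissible centre
    have hperm : permB q Finset.univ row.1.L = false := by
      rw [Bool.not_eq_true'] at hterm; exact hterm
    exact Game.Wins.terminal fun S hS => no_permissible_of_not_permB hperm S hS.2
  · rw [Bool.and_eq_true, decide_eq_true_eq] at hmove
    obtain ⟨hS, hall⟩ := hmove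
    by_cases hsc : InCoordinateScope q row.1.toState.F
    · refine Game.Wins.move (m := row.2.1)
        ⟨hsc, (isPermissibleCentre_iff q row.2.1 row.1.L).mpr hS⟩ ?_
      rintro s' ⟨j, b, hj, hbj, hρ, heq, hne, rfl⟩
      have h := hall j hj b hbj hρ
      unfold ireplyOK at h
      rw [Bool.or_eq_true, Bool.or_eq_true] at h
      rcases h with (h1 | h2) | h3
      · rw [Bool.not_eq_true', ← Bool.not_eq_true] at h1
        exact absurd ((isEquimultiplePoint_iff q row.2.1 j b row.1).mp heq) h1
      · exact absurd h2
          (by rw [Bool.not_eq_true]; exact (step_F_ne_zero_iff q row.2.1 j b row.1).mp hne)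
      · obtain ⟨r, hr, hrc⟩ := exists_of_ichildIn h3
        rw [step_toState, hrc]
        exact hrest r hr
    · exact Game.Wins.terminal fun _ hS' => hsc hS'.1

/-- **SOUNDNESS OF RESTRICTED WIN CERTIFICATES**: every state of a checked certificate is in A's attractor of
the `ρ`-restricted in-scope game over the finite field `K`. OURS. [folklore] -/
theorem rWins_of_rwinCertB {q : ℕ} {ρ : Finset (Fin 4) → Fin 4 → (Fin 4 → K) → Bool} :
    ∀ {T : ICert K}, rwinCertB q ρ T = true → ∀ row ∈ T, RWins q ρ row.1.toState
  | [], _ => fun row hrow => absurd hrow List.not_mem_nil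
  | row :: rest, h => by
    unfold rwinCertB at h
    rw [Bool.and_eq_true] at h
    have hrest := rWins_of_rwinCertB h.2
    intro r hr
    rcases List.mem_cons.mp hr with rfl | hr'
    · exact rWins_of_rrowOK hrest h.1
    · exact hrest r hr'

end Cert

/-! ## §3 LOOP-C, local side: the data checks over `𝔽₃` -/

/-- **No local reply at `t1`**: blowing up its unique maximal-dimensional component `V(x₂,x₄)` (`{1,3}`), no
`𝔽₃`-rational point OVER THE CURRENT POINT of either chart is equimultiple. [OURS · ‖ K] -/
theorem no_local_reply_t1 : ∀ j ∈ ({1, 3} : Finset (Fin 4)), ∀ b : Fin 4 → ZMod 3, b j = 0 →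
    localB {1, 3} j b = true → equiB 3 {1, 3} j b t1 = false := by decide +kernel

/-- **No local reply at `t2`** (`= s2`, component `V(x₁,x₄)` = `{0,3}`). [OURS · ‖ K] -/
theorem no_local_reply_t2 : ∀ j ∈ ({0, 3} : Finset (Fin 4)), ∀ b : Fin 4 → ZMod 3, b j = 0 →
    localB {0, 3} j b = true → equiB 3 {0, 3} j b t2 = false := by decide +kernel

/-- **No local reply at `t4`** (mirror, component `V(x₂,x₃)` = `{1,2}`). [OURS · ‖ K] -/
theorem no_local_reply_t4 : ∀ j ∈ ({1, 2} : Finset (Fin 4)), ∀ b : Fin 4 → ZMod 3, b j = 0 →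
    localB {1, 2} j b = true → equiB 3 {1, 2} j b t4 = false := by decide +kernel

/-- **No local reply at `t5`** (`= s4`, component `V(x₁,x₃)` = `{0,2}`). [OURS · ‖ K] -/
theorem no_local_reply_t5 : ∀ j ∈ ({0, 2} : Finset (Fin 4)), ∀ b : Fin 4 → ZMod 3, b j = 0 →
    localB {0, 2} j b = true → equiB 3 {0, 2} j b t5 = false := by decide +kernel

/-- Tree form of `no_local_reply_t2`: at `s2` the blow-up of `V(x₁,x₄)` has no `𝔽₃`-rational equimultiple
point over the current point — the max-dimensional-component rule WINS the local game from `s2` at once.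
[OURS · ‖ K] -/
theorem not_isEquimultiplePoint_t2_local {j : Fin 4} (hj : j ∈ ({0, 3} : Finset (Fin 4)))
    {b : Fin 4 → ZMod 3} (hbj : b j = 0) (hb : ∀ i : Fin 4, i ∉ ({0, 3} : Finset (Fin 4)) → b i = 0) :
    ¬ IsEquimultiplePoint 3 {0, 3} j b t2.toState := by
  rw [isEquimultiplePoint_iff, no_local_reply_t2 j hj b hbj ((localB_eq_true_iff _ j b).mpr hb)]
  exact Bool.false_ne_true

/-- **LOOP-C's replies at the one-component states are HOPS, not local replies**: the recorded points
`(0,0,2,1)` at `t1`/`t2` and `(0,0,1,2)` at `t4`/`t5` of `LoopC.loopC` move a coordinate OFF the centre.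
[OURS · ‖ K] -/
theorem hops_not_local :
    localB ({1, 3} : Finset (Fin 4)) 1 (![0, 0, 2, 1] : Fin 4 → ZMod 3) = false ∧
    localB ({0, 3} : Finset (Fin 4)) 0 (![0, 0, 2, 1] : Fin 4 → ZMod 3) = false ∧
    localB ({1, 2} : Finset (Fin 4)) 1 (![0, 0, 1, 2] : Fin 4 → ZMod 3) = false ∧
    localB ({0, 2} : Finset (Fin 4)) 0 (![0, 0, 1, 2] : Fin 4 → ZMod 3) = false := by
  decide +kernel

/-- **The local win certificate for the LOOP-C region**: rows (state, A's centre) — A plays the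
maximal-dimensional components `V(x₁,x₄)` at `t0`, `t2` and `V(x₂,x₄)` at `t1` (mirrors at `t3…t5`); B's
local replies are: at `t0`/`t3` only the chart origin (→ `t1`/`t4`), at `t1,t2,t4,t5` none. [OURS · data] -/
def loopCLocalCert : ICert (ZMod 3) :=
  [(t0, {0, 3}, none), (t3, {0, 2}, none), (t1, {1, 3}, none), (t2, {0, 3}, none), (t4, {1, 2}, none),
    (t5, {0, 2}, none)]

/-- The local certificate checks. [OURS · ‖ K] -/
theorem rwinCertB_loopCLocal : rwinCertB 3 localB loopCLocalCert = true := by decide +kernel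

/-! ## §4 Conclusions: LOOP-C separates the global from the local game -/

/-- **Every LOOP-C region state is an A-win of the LOCAL in-scope game over `𝔽₃`** (A blowing up
maximal-dimensional components, B confined to the current point): within two moves B has no equimultiple
reply left. [OURS · ‖ K] -/
theorem loopC_localWins : ∀ s ∈ trapSet loopC, RWins 3 localB s := by
  have hcert := rWins_of_rwinCertB rwinCertB_loopCLocal
  rintro s ⟨sw, hsw, rfl⟩
  simp only [loopC, List.mem_cons, List.not_mem_nil, or_false] at hsw
  rcases hsw with rfl | rfl | rfl | rfl | rfl | rfl
  · exact hcert (t0, {0, 3}, none) (by simp [loopCLocalCert])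
  · exact hcert (t1, {1, 3}, none) (by simp [loopCLocalCert])
  · exact hcert (t2, {0, 3}, none) (by simp [loopCLocalCert])
  · exact hcert (t3, {0, 2}, none) (by simp [loopCLocalCert])
  · exact hcert (t4, {1, 2}, none) (by simp [loopCLocalCert])
  · exact hcert (t5, {0, 2}, none) (by simp [loopCLocalCert])

/-- In particular the root `t0 = s1` of LOOP-C is a local A-win. [OURS · ‖ K] -/
theorem t0_localWins : RWins 3 localB t0.toState := loopC_localWins _ t0_mem_loopC

/-- **LOOP-C SEPARATES F4-C-glob FROM F4-C-loc at `(3,3)` over `𝔽₃`**: (i) in the GLOBAL game every coordinate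
rule that blows up a maximal-dimensional component whenever one exists has an infinite branch of in-scope
states inside the region (p-8 g2's `LoopC.exists_inScope_branch_of_maxDimRule`); (ii) in the LOCAL game every
state of the same region is an A-win, A playing maximal-dimensional components.  (No `𝔽₃`-rational local reply
is lost: §3 enumerates them all.) [OURS · ‖ K · located specimen of idea-2 g2; K = B per WORD #47 (c)] -/
theorem loopC_separates :
    (∀ R : CentreRule (ZMod 3),
      (∀ s : State (ZMod 3),
        (∃ S, ComponentThreads.IsComponent 3 S s.F ∧
            ∀ S', ComponentThreads.IsComponent 3 S' s.F → S.card ≤ S'.card) →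
          ComponentThreads.IsComponent 3 (R s) s.F ∧
            ∀ S', ComponentThreads.IsComponent 3 S' s.F → (R s).card ≤ S'.card) →
      ∃ c : ℕ → State (ZMod 3), (∀ k, c k ∈ trapSet loopC) ∧
        ∀ k, InCoordinateScope 3 (c k).F ∧ StepRule 3 R (c k) (c (k + 1))) ∧
    ∀ s ∈ trapSet loopC, RWins 3 localB s :=
  ⟨exists_inScope_branch_of_maxDimRule, loopC_localWins⟩

end LoopCLocal

end Summit.ResolutionOfSingularities.ResolutionOfSingularities.Theorems.PIDim4

end
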